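import Summits.CriticalPhenomena.PercolationContinuityZ3.Theorems.PercNearOneGluingNoHeavyRsw3InvasionCanonicalEnd
import HarnessLib

/-!
# RSW3 lane (P2, gen 29): INVASION PERCOLATION XLI — THE DICHOTOMY FOR TWO INVASION TREES: either their invaded regions are DISJOINT, or the trees differ in
# finitely many bonds and their backbones share a tail (every infinite connected locally finite graph, injective labels, outlets beyond every time; a.s. on `ℤ^d`)

builds on p205010 (kernel theorem, internal audit signed; external expert review pending) — used only in the `ℤ^d` statement (through file XXXVII).

Cell `prim-rsw3`, prover seat `prim-rsw3-p2` (gen 29), memo `run/shared/lean/prim/rsw3/P2-RSWLITE.md` §36.  Support file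
(`--supports stmt-CriticalPhenomena-4575`); no definitions, no named facts, no sorries.

Lyons–Peres–Schramm 2006, proof of Thm. 3.12: "each pair of invasion trees is either disjoint or shares all but finitely many vertices by Proposition 3.4".  Kernel form:
if the invasions from `x` and from `y` ever invade a common vertex `v`, then `x` and `y` are joined inside `𝔉_w(U)` (through `T(x) ∪ T(y) ⊆ 𝔉_w`, file XXXIV), so
Prop. 3.4 (files XXXVIII-a/b) and the canonical end (file XXXIX) apply:

* `wmsf_reachable_of_mem_invadedRegion`, `wmsf_reachable_of_common_vertex` — a common invaded vertex joins the roots in the WMSF graph.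
* **`invasionTrees_dichotomy`** — `Disjoint (invadedRegion x) (invadedRegion y)` OR `T(x) △ T(y)` finite; **`invasionTrees_dichotomy_rays`** — in the second case the
  backbones share a tail.
* **`ae_invasionTrees_dichotomy`** (`ℤ^d`, `d ≥ 2`, p205010): a.s. for all `x, y ∈ ℤ^d`: either the two invaded regions are disjoint, or the invasion trees differ in
  finitely many bonds and every ray of `T(x)` from `x` shares a tail with every ray of `T(y)` from `y`.

References: R. Lyons, Y. Peres, O. Schramm, Ann. Probab. 34 (2006), Prop. 3.4 and Thm. 3.12 (proof) [LyonsPeresSchramm2006].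
-/

noncomputable section

namespace Summit.CriticalPhenomena.PercolationContinuityZ3.Theorems.Rsw3

open Finset Filter MeasureTheory Literature.Probability.LatticeModels Literature.Probability.Percolation Literature.Probability.Percolation.Invasion

section General

variable {V : Type*} [DecidableEq V] {G : SimpleGraph V} [G.LocallyFinite]

/-- For labels injective on bonds, the invasion tree is a subgraph of the WMSF graph, so every invaded vertex is joined to the root inside `𝔉_w`.
[cite: LyonsPeresSchramm2006, Prop. 3.3] -/
theorem wmsf_reachable_of_mem_invadedRegion {U : Sym2 V → ℝ} (hU : Set.InjOn U G.edgeSet) {x v : V} (hv : v ∈ invadedRegion G U x) :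
    (SimpleGraph.fromEdgeSet (wmsf G U)).Reachable x v := by
  have hle : tree G U x ≤ SimpleGraph.fromEdgeSet (wmsf G U) := by
    intro a b h
    obtain ⟨he, hne⟩ := (tree_adj G).1 h
    exact (SimpleGraph.fromEdgeSet_adj _).2 ⟨treeEdges_subset_wmsf hU x he, hne⟩
  exact (tree_reachable_iff_mem_invadedRegion.2 hv).mono hle

/-- **A common invaded vertex joins the two roots inside the WMSF.** [cite: LyonsPeresSchramm2006, Thm. 3.12 (proof: "each pair of invasion trees is either disjoint or …")] -/
theorem wmsf_reachable_of_common_vertex {U : Sym2 V → ℝ} (hU : Set.InjOn U G.edgeSet) {x y v : V} (hvx : v ∈ invadedRegion G U x)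
    (hvy : v ∈ invadedRegion G U y) : (SimpleGraph.fromEdgeSet (wmsf G U)).Reachable x y :=
  (wmsf_reachable_of_mem_invadedRegion hU hvx).trans (wmsf_reachable_of_mem_invadedRegion hU hvy).symm

/-- **THE DICHOTOMY** (injective labels, infinite connected locally finite graph): two invasion trees either have DISJOINT invaded regions or differ in finitely many bonds
(LPS06 Prop. 3.4, files XXXVIII-a/b). [cite: LyonsPeresSchramm2006, Prop. 3.4 and Thm. 3.12 (proof)] -/
theorem invasionTrees_dichotomy [Infinite V] (hG : G.Preconnected) {U : Sym2 V → ℝ} (hU : Function.Injective U) (x y : V) :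
    Disjoint (invadedRegion G U x) (invadedRegion G U y) ∨ (symmDiff (treeEdges G U x) (treeEdges G U y)).Finite := by
  by_cases h : Disjoint (invadedRegion G U x) (invadedRegion G U y)
  · exact Or.inl h
  · right
    obtain ⟨v, hvx, hvy⟩ := Set.not_disjoint_iff.1 h
    exact treeEdges_symmDiff_finite_of_wmsf_reachable hG hU (wmsf_reachable_of_common_vertex hU.injOn hvx hvy)

/-- **The dichotomy with backbones**: if the invaded regions of `x` and `y` meet (outlets beyond every time and a ray from every root), the backbones share a tail.
[cite: LyonsPeresSchramm2006, Thm. 3.12 (proof: "a well-defined special end")] -/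
theorem invasionTrees_dichotomy_rays [Infinite V] (hG : G.Preconnected) {U : Sym2 V → ℝ} (hU : Function.Injective U)
    (hout : ∀ v : V, ∀ k, ∃ m, k ≤ m ∧ IsOutlet G U v m)
    (hray : ∀ v : V, ∃ R : ℕ → V, Function.Injective R ∧ R 0 = v ∧ ∀ i, (tree G U v).Adj (R i) (R (i + 1))) {x y : V}
    (hmeet : ¬ Disjoint (invadedRegion G U x) (invadedRegion G U y))
    {Rx : ℕ → V} (hRx : Function.Injective Rx) (hRx0 : Rx 0 = x) (hRxadj : ∀ i, (tree G U x).Adj (Rx i) (Rx (i + 1)))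
    {Ry : ℕ → V} (hRy : Function.Injective Ry) (hRy0 : Ry 0 = y) (hRyadj : ∀ i, (tree G U y).Adj (Ry i) (Ry (i + 1))) :
    ∃ a b, ∀ k, Rx (a + k) = Ry (b + k) := by
  obtain ⟨v, hvx, hvy⟩ := Set.not_disjoint_iff.1 hmeet
  exact rays_tail_equivalent_of_wmsf_reachable hG hU hout hray (wmsf_reachable_of_common_vertex hU.injOn hvx hvy) hRx hRx0 hRxadj hRy hRy0 hRyadj

end General

/-! ## `ℤ^d` -/

variable {d : ℕ}

/-- **THE DICHOTOMY FOR INVASION TREES OF `ℤ^d`** (`d ≥ 2`, p205010): almost surely, for all `x, y ∈ ℤ^d`, EITHER the invaded regions of `x` and `y` are disjoint, OR the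
invasion trees `T(x)`, `T(y)` differ in finitely many bonds and every self-avoiding ray of `T(x)` from `x` shares a tail with every self-avoiding ray of `T(y)` from `y`
(LPS06: "each pair of invasion trees is either disjoint or shares all but finitely many vertices"). [cite: LyonsPeresSchramm2006, Prop. 3.4 and Thm. 3.12 (proof)] -/
theorem ae_invasionTrees_dichotomy (hd : 2 ≤ d) :
    ∀ᵐ U ∂(labelMeasure (Site d)), ∀ x y : Site d,
      Disjoint (invadedRegion (zdGraph d) U x) (invadedRegion (zdGraph d) U y) ∨
      ((symmDiff (treeEdges (zdGraph d) U x) (treeEdges (zdGraph d) U y)).Finite ∧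
        ∀ rx ry : ℕ → Site d, Function.Injective rx → rx 0 = x → (∀ i, (tree (zdGraph d) U x).Adj (rx i) (rx (i + 1))) →
          Function.Injective ry → ry 0 = y → (∀ i, (tree (zdGraph d) U y).Adj (ry i) (ry (i + 1))) →
          ∃ a b, ∀ k, rx (a + k) = ry (b + k)) := by
  haveI : Nonempty (Fin d) := ⟨⟨0, by omega⟩⟩
  haveI : Infinite (Site d) := Pi.infinite_of_right
  filter_upwards [Literature.Barriers.CriticalPhenomena.ae_injective_labelMeasure (V := Site d), ae_forall_root_existsUnique_ray hd] with U hU hall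
  intro x y
  by_cases h : Disjoint (invadedRegion (zdGraph d) U x) (invadedRegion (zdGraph d) U y)
  · exact Or.inl h
  · refine Or.inr ⟨(invasionTrees_dichotomy zdGraph_preconnected_holds hU x y).resolve_left h, ?_⟩
    intro rx ry hrx hrx0 hrxadj hry hry0 hryadj
    exact invasionTrees_dichotomy_rays zdGraph_preconnected_holds hU (fun v => (hall v).1) (fun v => (hall v).2.exists) h
      hrx hrx0 hrxadj hry hry0 hryadj

end Summit.CriticalPhenomena.PercolationContinuityZ3.Theorems.Rsw3
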